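import Summits.QuantumFields.BalabanUV.Beta.SymCorrectorPair

/-!
# `BalabanUV.Beta.SymCorrectorRest` — binder row D1, road «BF-x» junction (J1), the `Δ_n` Ward program (an2 R-D1-g43-3 (2)), brick TT6 = the (W-rest) letters (i)–(iii) of the
# road OWNER's located ask W-g23-7 (journal l.49012) for opening the (D-R) word of `HOME/b2b-balaban-beta-d1-p2/J1-DEFECT-WORDS.md` v0.1 §3 at the road's kernel:
#   (i) `vertexOfM (Ψ̂∘K∘Ψ̂ᵀ) n M = vertexOfM K n M` (ANY `K`, `M`: the multiplier column reads the mm block); (iii) the slot adjunction for a LOCALISED middle kernel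
#   `vertexOfK (Ψ̂∘X∘Ψ̂ᵀ) n S = vertexOfK X n (slotPsiS r n S)` (`Loc X`; TT3b's proof with `Spr` relaxed to TAME); (ii) `dM (Ψ̂∘K∘Ψ̂ᵀ) n S M ν y′ = vertexOfK K n (slotPsiS S) ν y′
#   + vertexOfM K n M ν y′` and **`K2OfK (Ψ̂∘K∘Ψ̂ᵀ) n S M ν y′ = Ψ̂ ∘ Y ∘ Ψ̂ᵀ`**, `Y := −(K ∘ (Ψ̂ᵀ ∘ dM (Ψ̂∘K∘Ψ̂ᵀ) n S M ν y′ ∘ Ψ̂) ∘ K)` LOCALISED, whence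
#   **`dM (K2OfK (Ψ̂∘K∘Ψ̂ᵀ) …) n S M μ y = dM Y n (slotPsiS S) M μ y`**; (iv) **`mixOfK (Ψ̂∘K∘Ψ̂ᵀ) n M₂ μ y ν y′ = mixOfK K n (slotPsiS r n M₂) μ y ν y′`** (`slotPsiS_vertexOfM_comm`);
#   (v) with TT4: **`W2OfK (Ψ̂∘K∘Ψ̂ᵀ) n S M S₂ M₂ μ y ν y′ = vertex2OfK K n T₂ μ y ν y′ + mixOfK K n (slotPsiS M₂) μ y ν y′ + mixOfK K n (slotPsiS M₂) ν y′ μ y + dM Y n (slotPsiS S) M μ y`**,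
#   `T₂ α x := slotPsiS (slotPsiS S₂ α x)` (expanded in §5 into raw + outer∕inner∕both face pieces) — the (D-R)+(W-pair) words of `W2OfK` at the road's kernel, word by word.

HONEST FRAMING (cell contract, verbatim): «discharging `BetaPertH` makes Bałaban's UV stability UNCONDITIONAL — a real constructive-QFT result; it
is NOT the continuum limit and NOT the Clay problem.»  HONEST DEPENDENCY (verbatim): «continuum YM on T⁴ ⇐ BetaPertH ∧ nine spine estimates (0/9
proved); BetaPertH ⇐ (D1) ∧ (D4) ∧ CAP+tail; G-an2-4 gates asym, D1 and NE2/3/4.»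
ABSOLUTE RULE (cell, verbatim): «No internally-minted statement may enter as a cited fact. Every hypothesis is either kernel-proved in this package or a
verbatim quotation of a PUBLISHED theorem with page reference. The manuscript(s) under audit are NOT citable for their own disputed steps — they are the
thing under adjudication; programme-internal (2001/route/tribunal) claims are never citable.»  NOTHING is cited; no `def`, no `Prop` fact, 0 sorry; [folklore] tame-kernel
bookkeeping over the cell's OWN typed objects BY NAME (an5's `TameKernelCalculus`, the Literature's `SecondOrderResponse`).  Prices NO row, asserts NO currency (OWNER F-g22-2);
discharges NOTHING of (K), of hW ∕ hR ∕ D1Tel ∕ D1Rep (0∕4), of D1 or of BetaPertH; NOT continuum, NOT Clay.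

Provenance: D1 formalisation swarm, unit `b2b-balaban-beta-d1-formalise-leaf-03` (gen 29), 2026-08-23; imports TT4 `SymCorrectorPair`; no existing file touched.
-/

namespace Summit.QuantumFields.BalabanUV.Beta.SymCorrectorRest

open Finset
open scoped BigOperators
open Literature.MathematicalPhysics.QuantumFieldTheory
open Literature.MathematicalPhysics.QuantumFieldTheory.Balaban1983to89
open Literature.MathematicalPhysics.QuantumFieldTheory.Balaban1983to89.Beta
open B12Sec2to5 (l1 l1_nonneg)
open ExpKernelCalculus (MKer Decays BiLoc comp Zl Zl_nonneg l1_sub_symm l1_natSmul summable_exp_shift')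
open OneStepResolventKernel (Fib wsum LocStencil)
open OneStepKernelFamily (colH vertexOfK abs_colH_le)
open InterLevelTransport (cwsum cwsum_apply onLat)
open SecondOrderResponse (colM vertexOfM dM dM_apply K2OfK mixOfK W2OfK W2OfK_apply vertex2OfK LocStencilFM abs_colM_le biLoc_vertexOfM_slice)
open BalabanCompositeJets (LocStencil₂)
open Summit.QuantumFields.BalabanUV.Beta.SymCorrectorPair (vertex2OfK_conj_psiKS)
open AffineAveraging (Site Form1 box toSite)
open AveragingContours (blk)
open Summit.QuantumFields.BalabanUV.Beta.TameKernelCalculus (Spr Loc Tame trK trK_apply trK_trK trK_comp comp_assoc_tame Spr.tame Loc.tame Spr.trK Loc.trK Spr.comp_loc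
  Loc.comp_spr Loc.neg Loc.add comp_neg_left comp_neg_right)
open Summit.QuantumFields.BalabanUV.Beta.ChartConjugationRelative (spr_comp)
open Summit.QuantumFields.BalabanUV.Beta.KernelWardRelative (gaugeWt)
open Summit.QuantumFields.BalabanUV.Beta.SymCorrectorKernel (psiKS comp_psiKS_inr comp_trK_psiKS_inr spr_psiKS)
open Summit.QuantumFields.BalabanUV.Beta.SymCorrectorFace (faceWt bondNbhd slotPsiS slotPsiS_apply slotPsiS_apply_kernel)
open Summit.QuantumFields.BalabanUV.Beta.SymCorrectorSlot (colK loc_colK comp_trK_colK_apply comp_trK_psiKS_colK trK_conj abs_slotPsiS_le_of_bounded abs_stencil_le_exp_left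
  vertexOfK_conj_psiKS vertexOfK_conj_psiKS_apply)

noncomputable section

variable {d : ℕ}

/-! ## §1 (i) The multiplier column and the multiplier vertex do not see the corrector -/

section Mult

variable (r : Fin (d + 1) → ℕ) (n : ℕ)

/-- [folklore] The mm block of a `Ψ̂_S`-conjugate is untouched (TT2b `conj_psiKS_inr_inr`, re-derived from TT2a's `comp_trK_psiKS_inr ∕ comp_psiKS_inr` to keep the import light). -/
theorem conj_psiKS_inr_inr' (K : MKer (d + 1) (Fib d)) (x z : Site (d + 1)) (m m' : Fin (d + 1)) :
    comp (comp (psiKS r n) K) (trK (psiKS r n)) x z (Sum.inr m) (Sum.inr m') = K x z (Sum.inr m) (Sum.inr m') := by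
  rw [comp_trK_psiKS_inr, comp_psiKS_inr]

/-- [folklore] **THE MULTIPLIER COLUMN OF A `Ψ̂_S`-CONJUGATE IS THE KERNEL's**: `colM (Ψ̂∘K∘Ψ̂ᵀ) n μ y = colM K n μ y`. -/
theorem colM_conj_psiKS (K : MKer (d + 1) (Fib d)) (μ : Fin (d + 1)) (y : Site (d + 1)) :
    colM (comp (comp (psiKS r n) K) (trK (psiKS r n))) n μ y = colM K n μ y := by
  funext ρ w
  exact conj_psiKS_inr_inr' r n K _ _ ρ μ

/-- [folklore] **(i) `vertexOfM (Ψ̂∘K∘Ψ̂ᵀ) n M = vertexOfM K n M`** for ANY kernel `K` and ANY multiplier family `M`. -/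
theorem vertexOfM_conj_psiKS (K : MKer (d + 1) (Fib d)) (M : Fin (d + 1) → Site (d + 1) → MKer (d + 1) (Fib d)) :
    vertexOfM (comp (comp (psiKS r n) K) (trK (psiKS r n))) n M = vertexOfM K n M := by
  funext μ y x z a b
  simp only [vertexOfM, colM_conj_psiKS]

end Mult

/-! ## §2 (iii) The slot adjunction for a LOCALISED (tame) middle kernel -/

section TameSlot

/-- [folklore] A column of a TAME kernel against a bounded scalar family is absolutely summable (`ColMaj`). -/
theorem summable_col_mul_of_tame {K : MKer (d + 1) (Fib d)} (hK : Tame K) (v : Site (d + 1)) (f : Fib d) (b : Fib d) {g : Site (d + 1) → ℝ} {B : ℝ}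
    (hg : ∀ u, |g u| ≤ B) : Summable fun u => K u v f b * g u := by
  obtain ⟨ψ, hψ, hψ0, hle⟩ := hK.2.1 v
  refine Summable.of_norm_bounded (hψ.mul_right B) fun u => ?_
  rw [Real.norm_eq_abs, abs_mul]
  exact mul_le_mul (hle u f b) (hg u) (abs_nonneg _) (hψ0 u)

/-- [folklore] `vertexOfK K n S μ y x z a b = (Kᵀ ∘ colK T w₀ b₀)((n•y, inr μ), (w₀, b₀))` for a TAME `K` and `S` bounded at the entry (TT3b's `vertexOfK_eq_comp_trK_colK` with `Decays` relaxed). -/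
theorem vertexOfK_eq_comp_trK_colK_tame {n : ℕ} {K : MKer (d + 1) (Fib d)} (hK : Tame K)
    {S : Fin (d + 1) → Site (d + 1) → MKer (d + 1) (Fib d)} (x z : Site (d + 1)) (a b : Fib d) {B : ℝ} (hB : ∀ κ u, |S κ u x z a b| ≤ B)
    (μ : Fin (d + 1)) (y w₀ : Site (d + 1)) (b₀ : Fib d) :
    vertexOfK K n S μ y x z a b = comp (trK K) (colK (fun κ u => S κ u x z a b) w₀ b₀) ((n : ℤ) • y) w₀ (Sum.inr μ) b₀ := by
  rw [comp_trK_colK_apply _ w₀ b₀ K _ _ fun κ => summable_col_mul_of_tame hK _ _ _ (hB κ)]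
  rfl

/-- [folklore] A `Ψ̂_S`-conjugate of a localised kernel is localised (`Spr.comp_loc`, `Loc.comp_spr`). -/
theorem loc_conj_psiKS {n : ℕ} (hn : 0 < n) {r : Fin (d + 1) → ℕ} (hr : r ∈ box (d + 1) n) {X : MKer (d + 1) (Fib d)} (hX : Loc X) :
    Loc (comp (comp (psiKS r n) X) (trK (psiKS r n))) :=
  ((spr_psiKS hn hr).comp_loc hX).comp_spr (spr_psiKS hn hr).trK

/-- [folklore] **(iii) THE SLOT ADJUNCTION FOR A LOCALISED MIDDLE KERNEL, ENTRYWISE** (`Loc X`; the slot family at the entry localised at any centre; every factor TAME). -/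
theorem vertexOfK_conj_psiKS_apply_loc {n : ℕ} (hn : 0 < n) {r : Fin (d + 1) → ℕ} (hr : r ∈ box (d + 1) n) {X : MKer (d + 1) (Fib d)} (hX : Loc X)
    (S : Fin (d + 1) → Site (d + 1) → MKer (d + 1) (Fib d)) (μ : Fin (d + 1)) (y x z : Site (d + 1)) (a b : Fib d)
    {p : Site (d + 1)} {C δ : ℝ} (hδ : 0 < δ) (hT : ∀ κ u, |S κ u x z a b| ≤ C * Real.exp (-δ * l1 (u - p))) :
    vertexOfK (comp (comp (psiKS r n) X) (trK (psiKS r n))) n S μ y x z a b = vertexOfK X n (slotPsiS r n S) μ y x z a b := by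
  have hΨ : Spr (psiKS r n) := spr_psiKS hn hr
  have hX' : Loc (comp (comp (psiKS r n) X) (trK (psiKS r n))) := loc_conj_psiKS hn hr hX
  have hC : 0 ≤ C := by
    have h := hT μ p
    rw [sub_self, show l1 (0 : Site (d + 1)) = 0 by simp [l1], mul_zero, Real.exp_zero, mul_one] at h
    exact (abs_nonneg _).trans h
  have hB : ∀ κ u, |(fun κ u => S κ u x z a b) κ u| ≤ C := fun κ u =>
    (hT κ u).trans (by
      have : Real.exp (-δ * l1 (u - p)) ≤ 1 := by rw [Real.exp_le_one_iff]; nlinarith [l1_nonneg (u - p)]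
      nlinarith)
  have hB' : ∀ κ u, |slotPsiS r n S κ u x z a b| ≤ C * (1 + SymCorrectorFace.faceWtSum r n * (((d + 1 : ℕ) : ℝ) * (2 * (n : ℝ) ^ (d + 1)))) := by
    intro κ u
    rw [slotPsiS_apply_kernel]
    exact abs_slotPsiS_le_of_bounded hn r hB κ u
  have hcol : Loc (colK (fun κ u => S κ u x z a b) z b) := loc_colK z b hC hδ hT
  rw [vertexOfK_eq_comp_trK_colK_tame hX'.tame x z a b hB μ y z b, vertexOfK_eq_comp_trK_colK_tame hX.tame x z a b hB' μ y z b]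
  have eT : (fun κ u => slotPsiS r n S κ u x z a b) = slotPsiS r n (fun κ u => S κ u x z a b) := by
    funext κ u; exact slotPsiS_apply_kernel r n S κ u x z a b
  rw [eT, ← comp_trK_psiKS_colK hn hr, trK_conj, ← comp_assoc_tame hΨ.tame (hX.trK.comp_spr hΨ.trK).tame hcol.tame, comp_psiKS_inr,
    ← comp_assoc_tame hX.trK.tame hΨ.trK.tame hcol.tame]

/-- [folklore] **(iii) for local stencil families**: `Loc X`, `LocStencil S Cs δ` (`0 < δ`) ⟹ `vertexOfK (Ψ̂_S∘X∘Ψ̂_Sᵀ) n S μ y = vertexOfK X n (slotPsiS r n S) μ y`. -/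
theorem vertexOfK_conj_psiKS_loc {n : ℕ} (hn : 0 < n) {r : Fin (d + 1) → ℕ} (hr : r ∈ box (d + 1) n) {X : MKer (d + 1) (Fib d)} (hX : Loc X)
    {S : Fin (d + 1) → Site (d + 1) → MKer (d + 1) (Fib d)} {Cs δs : ℝ} (hS : LocStencil S Cs δs) (hδs : 0 < δs) (μ : Fin (d + 1)) (y : Site (d + 1)) :
    vertexOfK (comp (comp (psiKS r n) X) (trK (psiKS r n))) n S μ y = vertexOfK X n (slotPsiS r n S) μ y := by
  funext x z a b
  exact vertexOfK_conj_psiKS_apply_loc hn hr hX S μ y x z a b hδs (fun κ u => abs_stencil_le_exp_left hS hδs.le κ u x z a b)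

end TameSlot

/-! ## §3 (ii) The first background derivative and the derivative of the inverse of a conjugated kernel -/

section Deriv

variable {n : ℕ} (hn : 0 < n) {r : Fin (d + 1) → ℕ} (hr : r ∈ box (d + 1) n)
include hn hr

/-- [folklore] **(ii, first half) `dM (Ψ̂_S∘K∘Ψ̂_Sᵀ) n S M ν y′ = vertexOfK K n (slotPsiS r n S) ν y′ + vertexOfM K n M ν y′`** (TT3b's adjunction + (i)). -/
theorem dM_conj_psiKS {K : MKer (d + 1) (Fib d)} (hK : Spr K) {S : Fin (d + 1) → Site (d + 1) → MKer (d + 1) (Fib d)} {Cs δs : ℝ}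
    (hS : LocStencil S Cs δs) (hδs : 0 < δs) (M : Fin (d + 1) → Site (d + 1) → MKer (d + 1) (Fib d)) (ν : Fin (d + 1)) (y' : Site (d + 1)) :
    dM (comp (comp (psiKS r n) K) (trK (psiKS r n))) n S M ν y' = vertexOfK K n (slotPsiS r n S) ν y' + vertexOfM K n M ν y' := by
  funext x z a b
  rw [dM_apply, Pi.add_apply, Pi.add_apply, Pi.add_apply, Pi.add_apply, vertexOfK_conj_psiKS hn hr hK hS hδs, vertexOfM_conj_psiKS]

/-- [folklore] The inner kernel `−(K ∘ (Ψ̂_Sᵀ∘D∘Ψ̂_S) ∘ K)` of a localised `D` is localised. -/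
theorem loc_inner {K : MKer (d + 1) (Fib d)} (hK : Spr K) {D : MKer (d + 1) (Fib d)} (hD : Loc D) :
    Loc (-(comp (comp K (comp (comp (trK (psiKS r n)) D) (psiKS r n))) K)) :=
  ((hK.comp_loc (((spr_psiKS hn hr).trK.comp_loc hD).comp_spr (spr_psiKS hn hr))).comp_spr hK).neg

/-- [folklore] **(ii) `K2OfK (Ψ̂_S∘K∘Ψ̂_Sᵀ) n S M ν y′ = Ψ̂_S ∘ (−(K ∘ (Ψ̂_Sᵀ ∘ dM (Ψ̂_S∘K∘Ψ̂_Sᵀ) n S M ν y′ ∘ Ψ̂_S) ∘ K)) ∘ Ψ̂_Sᵀ`** — the `Ψ̂_S`-CONJUGATE of a LOCALISED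
kernel (tame associativity; `Loc` of `dM` displayed — e.g. `SecondOrderResponse.vertexFamily_dM`). -/
theorem K2OfK_conj_psiKS {K : MKer (d + 1) (Fib d)} (hK : Spr K) (S M : Fin (d + 1) → Site (d + 1) → MKer (d + 1) (Fib d)) (ν : Fin (d + 1))
    (y' : Site (d + 1)) (hD : Loc (dM (comp (comp (psiKS r n) K) (trK (psiKS r n))) n S M ν y')) :
    K2OfK (comp (comp (psiKS r n) K) (trK (psiKS r n))) n S M ν y'
      = comp (comp (psiKS r n) (-(comp (comp K (comp (comp (trK (psiKS r n)) (dM (comp (comp (psiKS r n) K) (trK (psiKS r n))) n S M ν y'))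
          (psiKS r n))) K))) (trK (psiKS r n)) := by
  set P : MKer (d + 1) (Fib d) := psiKS r n with hP
  set D : MKer (d + 1) (Fib d) := dM (comp (comp P K) (trK P)) n S M ν y' with hDdef
  have hΨ : Spr P := spr_psiKS hn hr
  have hΨt : Spr (trK P) := hΨ.trK
  have hPK : Spr (comp P K) := spr_comp hΨ hK
  have hK' : Spr (comp (comp P K) (trK P)) := spr_comp hPK hΨt
  have e0 : K2OfK (comp (comp P K) (trK P)) n S M ν y' = -(comp (comp (comp (comp P K) (trK P)) D) (comp (comp P K) (trK P))) := by
    funext x z a b; rfl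
  rw [e0]
  have hPtD : Loc (comp (trK P) D) := hΨt.comp_loc hD
  have hPtDP : Loc (comp (comp (trK P) D) P) := hPtD.comp_spr hΨ
  have hKm : Loc (comp K (comp (comp (trK P) D) P)) := hK.comp_loc hPtDP
  have hKmK : Loc (comp (comp K (comp (comp (trK P) D) P)) K) := hKm.comp_spr hK
  have h1 : comp (comp (comp P K) (trK P)) D = comp P (comp K (comp (trK P) D)) := by
    rw [← comp_assoc_tame hPK.tame hΨt.tame hD.tame, ← comp_assoc_tame hΨ.tame hK.tame hPtD.tame]
  have hKPtD : Loc (comp K (comp (trK P) D)) := hK.comp_loc hPtD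
  rw [h1, ← comp_assoc_tame hΨ.tame hKPtD.tame hK'.tame]
  have h2 : comp (comp K (comp (trK P) D)) (comp (comp P K) (trK P)) = comp (comp (comp K (comp (comp (trK P) D) P)) K) (trK P) := by
    rw [comp_assoc_tame hKPtD.tame hPK.tame hΨt.tame, comp_assoc_tame hKPtD.tame hΨ.tame hK.tame,
      ← comp_assoc_tame hK.tame hPtD.tame hΨ.tame]
  rw [h2, comp_assoc_tame hΨ.tame hKmK.tame hΨt.tame, comp_neg_right, comp_neg_left]

/-- [folklore] **`dM (K2OfK (Ψ̂_S∘K∘Ψ̂_Sᵀ) …) n S M μ y = dM Y n (slotPsiS r n S) M μ y`**, `Y := −(K ∘ (Ψ̂_Sᵀ ∘ dM (Ψ̂_S∘K∘Ψ̂_Sᵀ) n S M ν y′ ∘ Ψ̂_S) ∘ K)` — the (D-R) chain-rule word's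
outer slots read on `Y` with the field slot face-transported ((ii) + (iii) + (i); `LocStencil S`, `Loc` of the inner derivative displayed). -/
theorem dM_K2OfK_conj_psiKS {K : MKer (d + 1) (Fib d)} (hK : Spr K) {S : Fin (d + 1) → Site (d + 1) → MKer (d + 1) (Fib d)} {Cs δs : ℝ}
    (hS : LocStencil S Cs δs) (hδs : 0 < δs) (M : Fin (d + 1) → Site (d + 1) → MKer (d + 1) (Fib d)) (ν : Fin (d + 1)) (y' : Site (d + 1))
    (hD : Loc (dM (comp (comp (psiKS r n) K) (trK (psiKS r n))) n S M ν y')) (μ : Fin (d + 1)) (y : Site (d + 1)) :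
    dM (K2OfK (comp (comp (psiKS r n) K) (trK (psiKS r n))) n S M ν y') n S M μ y
      = dM (-(comp (comp K (comp (comp (trK (psiKS r n)) (dM (comp (comp (psiKS r n) K) (trK (psiKS r n))) n S M ν y')) (psiKS r n))) K))
          n (slotPsiS r n S) M μ y := by
  rw [K2OfK_conj_psiKS hn hr hK S M ν y' hD]
  funext x z a b
  rw [dM_apply, dM_apply, vertexOfK_conj_psiKS_loc hn hr (loc_inner hn hr hK hD) hS hδs, vertexOfM_conj_psiKS]

end Deriv

/-! ## §4 (iv) The mixed bi-vertex: the field slot transports, the multiplier slot is untouched -/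

section Mixed

variable {n : ℕ}

/-- [folklore] A decaying multiplier column against a bounded coarse-indexed scalar family is absolutely summable. -/
theorem summable_colM_mul_of_bounded (hn : 0 < n) {K : MKer (d + 1) (Fib d)} {C δ : ℝ} (hK : Decays K C δ) (hδ : 0 < δ) (μ : Fin (d + 1))
    (y : Site (d + 1)) (ρ : Fin (d + 1)) {g : Site (d + 1) → ℝ} {B : ℝ} (hg : ∀ w, |g w| ≤ B) : Summable fun w => colM K n μ y ρ w * g w := by
  have hC : 0 ≤ C := hK.nonneg (Sum.inl 0)
  refine Summable.of_norm_bounded (((summable_exp_shift' hδ y).mul_left C).mul_right B) fun w => ?_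
  rw [Real.norm_eq_abs, abs_mul]
  refine mul_le_mul ((abs_colM_le (N := n) hK μ y ρ w).trans ?_) (hg w) (abs_nonneg _) (by positivity)
  refine mul_le_mul_of_nonneg_left (Real.exp_le_exp.2 ?_) hC
  rw [← smul_sub, l1_natSmul]
  have h1 : (1 : ℝ) ≤ n := by exact_mod_cast hn
  have h2 : δ * l1 (w - y) * 1 ≤ δ * l1 (w - y) * n := mul_le_mul_of_nonneg_left h1 (mul_nonneg hδ.le (l1_nonneg _))
  linarith

/-- [folklore] **THE SLOT TRANSPORT IN THE FIELD BOND COMMUTES WITH THE MULTIPLIER VERTEX IN THE OTHER BOND**: for a decaying `K` and a family `F` of multiplier families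
with bounded entries, `slotPsiS r n (κ u ↦ vertexOfM K n (F κ u) ν y′) = fun α x => vertexOfM K n (slotPsiS r n F α x) ν y′`. -/
theorem slotPsiS_vertexOfM_comm (hn : 0 < n) {K : MKer (d + 1) (Fib d)} {C δ : ℝ} (hK : Decays K C δ) (hδ : 0 < δ) (r : Fin (d + 1) → ℕ)
    (F : Fin (d + 1) → Site (d + 1) → Fin (d + 1) → Site (d + 1) → MKer (d + 1) (Fib d)) {B : ℝ} (hB : ∀ κ u ρ w p q a b, |F κ u ρ w p q a b| ≤ B)
    (ν : Fin (d + 1)) (y' : Site (d + 1)) :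
    slotPsiS r n (fun κ u => vertexOfM K n (F κ u) ν y') = fun α x => vertexOfM K n (slotPsiS r n F α x) ν y' := by
  classical
  haveI : NeZero n := ⟨hn.ne'⟩
  funext α x p q a b
  rw [slotPsiS_apply_kernel]
  have eL : slotPsiS r n (fun κ u => vertexOfM K n (F κ u) ν y' p q a b) α x
      = (∑ ρ : Fin (d + 1), ∑' w, colM K n ν y' ρ w * F α x ρ w p q a b)
        + faceWt r n α x * ∑ κ : Fin (d + 1), ∑ u ∈ bondNbhd n (blk n x) κ,
            gaugeWt n (blk n x) κ u * ∑ ρ : Fin (d + 1), ∑' w, colM K n ν y' ρ w * F κ u ρ w p q a b := by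
    rw [slotPsiS_apply]; simp only [smul_eq_mul, vertexOfM, cwsum_apply]
  have eR : vertexOfM K n (slotPsiS r n F α x) ν y' p q a b
      = ∑ ρ : Fin (d + 1), ∑' w, colM K n ν y' ρ w * ((F α x ρ w p q a b)
          + faceWt r n α x * ∑ κ : Fin (d + 1), ∑ u ∈ bondNbhd n (blk n x) κ, gaugeWt n (blk n x) κ u * F κ u ρ w p q a b) := by
    simp only [vertexOfM, cwsum_apply]
    refine Finset.sum_congr rfl fun ρ _ => tsum_congr fun w => ?_
    rw [slotPsiS_apply]
    simp only [Pi.add_apply, Pi.smul_apply, Finset.sum_apply, smul_eq_mul]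
  rw [eL, eR]
  have hs1 : ∀ ρ : Fin (d + 1), Summable fun w => colM K n ν y' ρ w * F α x ρ w p q a b := fun ρ =>
    summable_colM_mul_of_bounded hn hK hδ ν y' ρ fun w => hB α x ρ w p q a b
  have hs3 : ∀ (ρ κ : Fin (d + 1)) (u : Site (d + 1)), Summable fun w => colM K n ν y' ρ w * F κ u ρ w p q a b := fun ρ κ u =>
    summable_colM_mul_of_bounded hn hK hδ ν y' ρ fun w => hB κ u ρ w p q a b
  have e2 : ∀ ρ : Fin (d + 1), (fun w => colM K n ν y' ρ w * (faceWt r n α x * ∑ κ : Fin (d + 1), ∑ u ∈ bondNbhd n (blk n x) κ, gaugeWt n (blk n x) κ u * F κ u ρ w p q a b))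
      = fun w => ∑ κ : Fin (d + 1), ∑ u ∈ bondNbhd n (blk n x) κ, (faceWt r n α x * gaugeWt n (blk n x) κ u) * (colM K n ν y' ρ w * F κ u ρ w p q a b) := by
    intro ρ; funext w
    rw [Finset.mul_sum, Finset.mul_sum]
    refine Finset.sum_congr rfl fun κ _ => ?_
    rw [Finset.mul_sum, Finset.mul_sum]
    exact Finset.sum_congr rfl fun u _ => by ring
  have hs2 : ∀ ρ : Fin (d + 1), Summable fun w => colM K n ν y' ρ w
      * (faceWt r n α x * ∑ κ : Fin (d + 1), ∑ u ∈ bondNbhd n (blk n x) κ, gaugeWt n (blk n x) κ u * F κ u ρ w p q a b) := by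
    intro ρ; rw [e2 ρ]
    exact summable_sum fun κ _ => summable_sum fun u _ => (hs3 ρ κ u).mul_left _
  have step : ∀ ρ : Fin (d + 1), (∑' w, colM K n ν y' ρ w * ((F α x ρ w p q a b)
        + faceWt r n α x * ∑ κ : Fin (d + 1), ∑ u ∈ bondNbhd n (blk n x) κ, gaugeWt n (blk n x) κ u * F κ u ρ w p q a b))
      = (∑' w, colM K n ν y' ρ w * F α x ρ w p q a b)
        + faceWt r n α x * ∑ κ : Fin (d + 1), ∑ u ∈ bondNbhd n (blk n x) κ, gaugeWt n (blk n x) κ u * ∑' w, colM K n ν y' ρ w * F κ u ρ w p q a b := by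
    intro ρ
    have e1 : (fun w => colM K n ν y' ρ w * ((F α x ρ w p q a b)
        + faceWt r n α x * ∑ κ : Fin (d + 1), ∑ u ∈ bondNbhd n (blk n x) κ, gaugeWt n (blk n x) κ u * F κ u ρ w p q a b))
        = fun w => colM K n ν y' ρ w * F α x ρ w p q a b + colM K n ν y' ρ w
          * (faceWt r n α x * ∑ κ : Fin (d + 1), ∑ u ∈ bondNbhd n (blk n x) κ, gaugeWt n (blk n x) κ u * F κ u ρ w p q a b) := by
      funext w; ring
    rw [e1, (hs1 ρ).tsum_add (hs2 ρ), e2 ρ, Summable.tsum_finsetSum (fun κ _ => summable_sum fun u _ => (hs3 ρ κ u).mul_left _), Finset.mul_sum]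
    congr 1
    refine Finset.sum_congr rfl fun κ _ => ?_
    rw [Summable.tsum_finsetSum (fun u _ => (hs3 ρ κ u).mul_left _), Finset.mul_sum]
    refine Finset.sum_congr rfl fun u _ => ?_
    rw [tsum_mul_left]; ring
  rw [Finset.sum_congr rfl fun ρ _ => step ρ, Finset.sum_add_distrib]
  congr 1
  rw [← Finset.mul_sum]
  congr 1
  rw [Finset.sum_comm]
  refine Finset.sum_congr rfl fun κ _ => ?_
  rw [Finset.sum_comm]
  refine Finset.sum_congr rfl fun u _ => ?_
  rw [Finset.mul_sum]

/-- [folklore] A field–multiplier table entry is bounded by its constant (`0 ≤ δ`). -/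
theorem abs_mixed_slice_le {M₂ : Fin (d + 1) → Site (d + 1) → Fin (d + 1) → Site (d + 1) → MKer (d + 1) (Fib d)} {C₂ δ₂ : ℝ} (hM₂ : LocStencilFM n M₂ C₂ δ₂)
    (hδ₂ : 0 ≤ δ₂) (κ : Fin (d + 1)) (u : Site (d + 1)) (ρ : Fin (d + 1)) (w p q : Site (d + 1)) (a b : Fib d) : |M₂ κ u ρ w p q a b| ≤ C₂ := by
  have hC₂ : 0 ≤ C₂ := hM₂.nonneg
  refine (hM₂ κ u ρ w p q a b).trans ?_
  have h1 : Real.exp (-δ₂ * l1 (u - (n : ℤ) • w)) ≤ 1 := by rw [Real.exp_le_one_iff]; nlinarith [l1_nonneg (u - (n : ℤ) • w)]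
  have h2 : Real.exp (-δ₂ * (l1 (p - u) + l1 (q - u))) ≤ 1 := by rw [Real.exp_le_one_iff]; nlinarith [l1_nonneg (p - u), l1_nonneg (q - u)]
  calc C₂ * Real.exp (-δ₂ * l1 (u - (n : ℤ) • w)) * Real.exp (-δ₂ * (l1 (p - u) + l1 (q - u))) ≤ C₂ * 1 * 1 :=
        mul_le_mul (mul_le_mul_of_nonneg_left h1 hC₂) h2 (Real.exp_pos _).le (by positivity)
    _ = C₂ := by ring

/-- [folklore] The inner multiplier vertex of a mixed slice, read at an entry, is localised in the field bond at the entry's left site (`biLoc_vertexOfM_slice`). -/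
theorem abs_vertexOfM_slice_le_exp_left (hn : 0 < n) {K : MKer (d + 1) (Fib d)} {C m : ℝ} (hK : Decays K C m) (hm : 0 < m)
    {M₂ : Fin (d + 1) → Site (d + 1) → Fin (d + 1) → Site (d + 1) → MKer (d + 1) (Fib d)} {C₂ : ℝ} (hM₂ : LocStencilFM n M₂ C₂ m)
    (ν : Fin (d + 1)) (y' : Site (d + 1)) (κ : Fin (d + 1)) (u x z : Site (d + 1)) (a b : Fib d) :
    |vertexOfM K n (M₂ κ u) ν y' x z a b| ≤ ((d + 1 : ℕ) : ℝ) * (C * C₂ * Zl (d + 1) (m / 2)) * Real.exp (-m * l1 (u - x)) := by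
  haveI : NeZero n := ⟨hn.ne'⟩
  have hC : 0 ≤ C := hK.nonneg (Sum.inl 0)
  have hC₂ : 0 ≤ C₂ := hM₂.nonneg
  have hZ : 0 ≤ Zl (d + 1) (m / 2) := Zl_nonneg (half_pos hm)
  refine (biLoc_vertexOfM_slice (N := n) hK hC hM₂ hm κ u ν y' x z a b).trans ?_
  have e1 : Real.exp (-(m / 2) * l1 (u - (n : ℤ) • y')) ≤ 1 := by rw [Real.exp_le_one_iff]; nlinarith [l1_nonneg (u - (n : ℤ) • y')]
  have e2 : Real.exp (-m * (l1 (x - u) + l1 (z - u))) ≤ Real.exp (-m * l1 (u - x)) := by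
    rw [l1_sub_symm x u]; exact Real.exp_le_exp.2 (by nlinarith [l1_nonneg (z - u)])
  calc ((d + 1 : ℕ) : ℝ) * (C * C₂ * Zl (d + 1) (m / 2) * Real.exp (-(m / 2) * l1 (u - (n : ℤ) • y'))) * Real.exp (-m * (l1 (x - u) + l1 (z - u)))
      ≤ ((d + 1 : ℕ) : ℝ) * (C * C₂ * Zl (d + 1) (m / 2) * 1) * Real.exp (-m * l1 (u - x)) :=
        mul_le_mul (mul_le_mul_of_nonneg_left (mul_le_mul_of_nonneg_left e1 (by positivity)) (by positivity)) e2 (Real.exp_pos _).le (by positivity)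
    _ = _ := by ring

/-- [folklore] **(iv) THE MIXED BI-VERTEX OF A CONJUGATED KERNEL**: for spread `K`, `LocStencilFM n M₂ C₂ δ` (`0 < δ`) and an in-block root offset,
`mixOfK (Ψ̂_S∘K∘Ψ̂_Sᵀ) n M₂ μ y ν y′ = mixOfK K n (slotPsiS r n M₂) μ y ν y′` — the field slot face-transported (outer `slotPsiS` on `M₂` as a family in its field bond), the
multiplier slot untouched ((i) inside, TT3b's entrywise adjunction outside, `slotPsiS_vertexOfM_comm`).  The swapped word `mixOfK … ν y′ μ y` is the same statement. -/
theorem mixOfK_conj_psiKS (hn : 0 < n) {r : Fin (d + 1) → ℕ} (hr : r ∈ box (d + 1) n) {K : MKer (d + 1) (Fib d)} (hK : Spr K)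
    {M₂ : Fin (d + 1) → Site (d + 1) → Fin (d + 1) → Site (d + 1) → MKer (d + 1) (Fib d)} {C₂ δ₂ : ℝ} (hM₂ : LocStencilFM n M₂ C₂ δ₂) (hδ₂ : 0 < δ₂)
    (μ : Fin (d + 1)) (y : Site (d + 1)) (ν : Fin (d + 1)) (y' : Site (d + 1)) :
    mixOfK (comp (comp (psiKS r n) K) (trK (psiKS r n))) n M₂ μ y ν y' = mixOfK K n (slotPsiS r n M₂) μ y ν y' := by
  have hK2 := hK
  obtain ⟨CK, δK, hδK, hKd⟩ := hK2
  set m : ℝ := min δK δ₂ with hm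
  have hm0 : 0 < m := lt_min hδK hδ₂
  have hKm : Decays K |CK| m := TameKernelCalculus.decays_of_le hKd (min_le_left _ _)
  have hM₂m : LocStencilFM n M₂ C₂ m := hM₂.mono (min_le_right _ _)
  have e1 : (fun κ u => vertexOfM (comp (comp (psiKS r n) K) (trK (psiKS r n))) n (M₂ κ u) ν y') = fun κ u => vertexOfM K n (M₂ κ u) ν y' := by
    funext κ u; rw [vertexOfM_conj_psiKS]
  show vertexOfK (comp (comp (psiKS r n) K) (trK (psiKS r n))) n (fun κ u => vertexOfM (comp (comp (psiKS r n) K) (trK (psiKS r n))) n (M₂ κ u) ν y') μ y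
    = vertexOfK K n (fun κ u => vertexOfM K n (slotPsiS r n M₂ κ u) ν y') μ y
  rw [e1]
  funext x z a b
  rw [vertexOfK_conj_psiKS_apply hn hr hK (fun κ u => vertexOfM K n (M₂ κ u) ν y') μ y x z a b hm0
    (fun κ u => abs_vertexOfM_slice_le_exp_left hn hKm hm0 hM₂m ν y' κ u x z a b),
    slotPsiS_vertexOfM_comm hn hKd hδK r M₂ (fun κ u ρ w p q a b => abs_mixed_slice_le hM₂ hδ₂.le κ u ρ w p q a b) ν y']

end Mixed

/-! ## §5 The doubly transported pair family expanded: raw + outer face + inner face + face × face (the PAIR-FACE-PACK junction) -/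

section Expand

open Summit.QuantumFields.BalabanUV.Beta.SymCorrectorFace (faceSum)

variable {E : Type*} [AddCommGroup E] [Module ℝ E]

/-- [folklore] `faceSum` is additive in the family. -/
theorem faceSum_add (n : ℕ) (A B : Fin (d + 1) → Site (d + 1) → E) (Y : Site (d + 1)) : faceSum n (A + B) Y = faceSum n A Y + faceSum n B Y := by
  simp only [faceSum, Pi.add_apply, smul_add, Finset.sum_add_distrib]

/-- [folklore] `faceSum` is homogeneous in the family. -/
theorem faceSum_smul (n : ℕ) (c : ℝ) (A : Fin (d + 1) → Site (d + 1) → E) (Y : Site (d + 1)) : faceSum n (c • A) Y = c • faceSum n A Y := by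
  simp only [faceSum, Pi.smul_apply, smul_comm _ c, Finset.smul_sum]

/-- [folklore] **THE DOUBLY TRANSPORTED PAIR FAMILY, EXPANDED** (gan24-leaf-05 g58 «PAIR-FACE-PACK»'s three contact pieces + the raw table): at every pair slot
`slotPsiS r n (slotPsiS r n S₂ α x) κ′ u′ = S₂ α x κ′ u′ + faceWt α x • (faceSum n S₂ (blk x)) κ′ u′ + faceWt κ′ u′ • faceSum n (S₂ α x) (blk u′) + (faceWt α x · faceWt κ′ u′) • faceSum n (faceSum n S₂ (blk x)) (blk u′)`
— OUTER-indexed, INNER-indexed and BOTH-indexed pieces with one block table each. -/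
theorem slotPsiS₂_expand (r : Fin (d + 1) → ℕ) (n : ℕ) (S₂ : Fin (d + 1) → Site (d + 1) → Fin (d + 1) → Site (d + 1) → E) (α : Fin (d + 1)) (x : Site (d + 1))
    (κ' : Fin (d + 1)) (u' : Site (d + 1)) :
    slotPsiS r n (slotPsiS r n S₂ α x) κ' u'
      = S₂ α x κ' u' + faceWt r n α x • faceSum n S₂ (blk n x) κ' u' + faceWt r n κ' u' • faceSum n (S₂ α x) (blk n u')
        + (faceWt r n α x * faceWt r n κ' u') • faceSum n (faceSum n S₂ (blk n x)) (blk n u') := by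
  have eG : slotPsiS r n S₂ α x = S₂ α x + faceWt r n α x • faceSum n S₂ (blk n x) := rfl
  rw [slotPsiS, eG, faceSum_add, faceSum_smul, Pi.add_apply, Pi.add_apply, Pi.smul_apply, Pi.smul_apply, smul_add, smul_smul, mul_comm (faceWt r n κ' u')]
  abel

end Expand

/-! ## §6 (v) The whole second-order background family of a conjugated kernel, word by word -/

section Whole

variable {n : ℕ} (hn : 0 < n) {r : Fin (d + 1) → ℕ} (hr : r ∈ box (d + 1) n)
include hn hr

/-- [folklore] **THE (D-R)+(W-pair) WORDS: `W2OfK (Ψ̂∘K∘Ψ̂ᵀ) n S M S₂ M₂ μ y ν y′ = vertex2OfK K n T₂ μ y ν y′ + mixOfK K n M₂^Ψ μ y ν y′ + mixOfK K n M₂^Ψ ν y′ μ y + dM Y n S^Ψ M μ y`**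
with `T₂ α x := slotPsiS r n (slotPsiS r n S₂ α x)` (TT4), `M₂^Ψ := slotPsiS r n M₂`, `S^Ψ := slotPsiS r n S`, `Y := −(K ∘ (Ψ̂ᵀ ∘ dM (Ψ̂∘K∘Ψ̂ᵀ) n S M ν y′ ∘ Ψ̂) ∘ K)` —
every member of `SecondOrderResponse.W2OfK` at the conjugated kernel is `K`'s on face-transported tables (the inner derivative keeping its `Ψ̂`-dressed legs). -/
theorem W2OfK_conj_psiKS {K : MKer (d + 1) (Fib d)} (hK : Spr K)
    {S : Fin (d + 1) → Site (d + 1) → MKer (d + 1) (Fib d)} {Cs δs : ℝ} (hS : LocStencil S Cs δs) (hδs : 0 < δs)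
    (M : Fin (d + 1) → Site (d + 1) → MKer (d + 1) (Fib d))
    {S₂ : Fin (d + 1) → Site (d + 1) → Fin (d + 1) → Site (d + 1) → MKer (d + 1) (Fib d)} {C₂ δ₂ : ℝ} (hS₂ : LocStencil₂ S₂ C₂ δ₂) (hδ₂ : 0 < δ₂)
    {M₂ : Fin (d + 1) → Site (d + 1) → Fin (d + 1) → Site (d + 1) → MKer (d + 1) (Fib d)} {CM δM : ℝ} (hM₂ : LocStencilFM n M₂ CM δM) (hδM : 0 < δM)
    (μ : Fin (d + 1)) (y : Site (d + 1)) (ν : Fin (d + 1)) (y' : Site (d + 1))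
    (hD : Loc (dM (comp (comp (psiKS r n) K) (trK (psiKS r n))) n S M ν y')) :
    W2OfK (comp (comp (psiKS r n) K) (trK (psiKS r n))) n S M S₂ M₂ μ y ν y'
      = vertex2OfK K n (fun α x => slotPsiS r n (slotPsiS r n S₂ α x)) μ y ν y'
        + mixOfK K n (slotPsiS r n M₂) μ y ν y' + mixOfK K n (slotPsiS r n M₂) ν y' μ y
        + dM (-(comp (comp K (comp (comp (trK (psiKS r n)) (dM (comp (comp (psiKS r n) K) (trK (psiKS r n))) n S M ν y')) (psiKS r n))) K))
            n (slotPsiS r n S) M μ y := by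
  rw [W2OfK_apply, vertex2OfK_conj_psiKS hn hr hK hS₂ hδ₂, mixOfK_conj_psiKS hn hr hK hM₂ hδM, mixOfK_conj_psiKS hn hr hK hM₂ hδM,
    dM_K2OfK_conj_psiKS hn hr hK hS hδs M ν y' hD]

end Whole

end

end Summit.QuantumFields.BalabanUV.Beta.SymCorrectorRest
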